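import Mathlib
import HarnessLib
import Literature.Analysis.FluidPDE.ClassicalSolution
import Literature.Analysis.FluidPDE.LerayHopf
import Literature.Analysis.FluidPDE.NSVorticityBKMEnergy
import Literature.Analysis.FluidPDE.BKMClassTimeDerivativeL2
import Literature.Analysis.FluidPDE.NormalisedPressureDischarge
import Summits.NavierStokesRegularity.NavierStokesRegularity.Theorems.QuarterJoltEdgeLawClass

/-!
# Route QuarterJolt — crux `NoTerminalJolt` (stmt-NavierStokesRegularity-26463), LEAD line
# `regular_split` rev 4: the PAIRING RATE against a frozen regular field, I (static estimate)

Seat ns-ntj-p1 g3 (LEAD of the crux; `--supports 26463 --as helper`). First of two files proving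
that a first blow-up whose Leray–Hopf terminal value `u(T)` is a REGULAR field (smooth, bounded,
divergence free, `u(T), ∇u(T) ∈ L²`) JOLTS — the terminal pairing law (`QuarterJoltTerminalPairingLaw`,
p633723) reduces this to the rate `∫⟪u(t) − u(T), u(T)⟫ = o(√(T−t))`, which follows from the
momentum equation tested against the frozen field `U = u(T)`:
`d/dτ ∫⟪u(τ), U⟫ = ∫⟪∂ₜu(τ), U⟫ = −ν∫ Du(τ):DU − ∫⟪U, (u·∇)u(τ)⟫` (the pressure pairs to zero with
the divergence-free `U`), whence `|d/dτ ∫⟪u(τ), U⟫| ≲ ‖Du(τ)‖₂`.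

THIS FILE (static fields and the packaging at interior times of a closed slab, route-independent in
content; companion of `QuarterJoltEdgeLawSlice` / `QuarterJoltEdgeLawClass`, p625560 / p625983):

* `pairing_timeDeriv_abs_le` — for `v ∈ C²` bounded with `v, Dv, D²v ∈ L²`, `W ∈ C⁰ ∩ L²`,
  `π ∈ C¹ ∩ L²` with `W + (v·∇)v = νΔv − ∇π` (`ν ≥ 0`), and a frozen `U ∈ C¹`, divergence free,
  `‖U‖ ≤ L`, `U, DU ∈ L²`: for every `η > 0`,
  `|∫⟪U, W⟫| ≤ ((ν+1)/2) η ∫|Dv|²_F + (ν∫|DU|²_F + L²∫‖v‖²)/(2η)`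
  (whole-space integration by parts `∫⟪Δv, U⟫ = −∫ Dv:DU`,
  `integral_sum_inner_fderiv_fderiv_eq_neg_integral_inner_laplacian`; the pressure pairs to zero,
  `integral_inner_gradient_eq_zero_of_isDivFree_R3`; Young's inequality pointwise).
* `pairing_timeDeriv_abs_le_of_classical` — the same at every interior time `τ` of a closed slab
  `[0,S]` for a classical solution in Tao's class (`HasBoundedSobolevNormsOn`), with `W = ∂ₜu(τ)`,
  `v = u(τ)` and the normalised pressure (Tao 2013 Lemma 4.1 (i), `pressure_sub_pressurePotential_eq`),
  exactly as in `EdgeLaw.slice_le_of_classical`.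

HONEST FRAMING: a priori calculus for classical solutions; nothing here concerns the truth of
`NoTerminalJolt` or Navier–Stokes regularity. No summit statement is proved here. [folklore]
-/

noncomputable section

-- the summit and its single sub-problem share the name (CONVENTIONS §1), as in every Theorems file
set_option linter.dupNamespace false

namespace Summit.NavierStokesRegularity.NavierStokesRegularity.Theorems

open MeasureTheory Set Function Filter Topology InnerProductSpace
open scoped ENNReal NNReal ContDiff RealInnerProductSpace Laplacian
open Literature.Analysis.FluidPDE

namespace NoTerminalJolt

/-- Pointwise Young inequality: `a b ≤ (η a² + η⁻¹ b²)/2` for `η > 0`. [folklore] -/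
theorem mul_le_young {a b η : ℝ} (hη : 0 < η) : a * b ≤ (η * a ^ 2 + η⁻¹ * b ^ 2) / 2 := by
  have h : 0 ≤ (η * a - b) ^ 2 / η := by positivity
  have e : (η * a - b) ^ 2 / η = η * a ^ 2 + η⁻¹ * b ^ 2 - 2 * (a * b) := by
    field_simp
    ring
  linarith [h, e]

/-- **The pairing of the time derivative with a frozen regular divergence-free field (static
fields).** Let `v ∈ C²(ℝ³; ℝ³)` be bounded by `M` with `v, Dv, D²v ∈ L²`; `W : ℝ³ → ℝ³` continuous
and in `L²`; `π ∈ C¹ ∩ L²`; and the momentum equation `W + (v·∇)v = νΔv − ∇π` (`ν ≥ 0`). Let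
`U ∈ C¹` be divergence free with `‖U‖ ≤ L` and `U, DU ∈ L²`. Then for every `η > 0`
`|∫⟪U, W⟫| ≤ ((ν+1)/2) η ∫|Dv|²_F + (ν∫|DU|²_F + L²∫‖v‖²)/(2η)`. [folklore] -/
theorem pairing_timeDeriv_abs_le {ν : ℝ} (hν : 0 ≤ ν)
    {v U W : EuclideanSpace ℝ (Fin 3) → EuclideanSpace ℝ (Fin 3)} {π : EuclideanSpace ℝ (Fin 3) → ℝ}
    (hv : ContDiff ℝ 2 v) (hU : ContDiff ℝ 1 U) (hW : Continuous W) (hπ : ContDiff ℝ 1 π)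
    (hmom : ∀ x, W x + convect v v x = ν • (Δ v) x - gradient π x)
    (hdivU : VectorCalculus.IsDivFree U)
    {M : ℝ} (hM : ∀ x, ‖v x‖ ≤ M) {L : ℝ} (hL : ∀ x, ‖U x‖ ≤ L)
    (l2v : ∫⁻ x, ‖v x‖ₑ ^ 2 < ⊤) (l2Dv : ∫⁻ x, ‖fderiv ℝ v x‖ₑ ^ 2 < ⊤)
    (l2D2v : ∫⁻ x, ‖iteratedFDeriv ℝ 2 v x‖ₑ ^ 2 < ⊤)
    (l2U : ∫⁻ x, ‖U x‖ₑ ^ 2 < ⊤) (l2DU : ∫⁻ x, ‖fderiv ℝ U x‖ₑ ^ 2 < ⊤)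
    (l2W : ∫⁻ x, ‖W x‖ₑ ^ 2 < ⊤) (l2π : ∫⁻ x, ‖π x‖ₑ ^ 2 < ⊤) {η : ℝ} (hη : 0 < η) :
    |∫ x, ⟪U x, W x⟫| ≤
      (ν + 1) / 2 * η * (∫ x, frobeniusNormSq (fderiv ℝ v x)) +
        (ν * (∫ x, frobeniusNormSq (fderiv ℝ U x)) + L ^ 2 * ∫ x, ‖v x‖ ^ 2) / (2 * η) := by
  set e := EuclideanSpace.basisFun (Fin 3) ℝ with he
  have he1 : ∀ i, ‖e i‖ = 1 := fun i => by simp [he]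
  have hv1 : ContDiff ℝ 1 v := hv.of_le (by norm_num)
  -- continuity
  have cv : Continuous v := hv.continuous
  have cU : Continuous U := hU.continuous
  have cDv : Continuous (fderiv ℝ v) := hv.continuous_fderiv (by norm_num)
  have cDU : Continuous (fderiv ℝ U) := hU.continuous_fderiv one_ne_zero
  have cD2v : Continuous fun x => iteratedFDeriv ℝ 2 v x := hv.continuous_iteratedFDeriv le_rfl
  have cπ : Continuous π := hπ.continuous
  have cDπ : Continuous (fderiv ℝ π) := hπ.continuous_fderiv one_ne_zero
  have cgπ : Continuous (gradient π) := continuous_gradient_of_contDiff hπ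
  have cΔ : Continuous (Δ v) := continuous_laplacian hv
  have cdiv : ∀ i, Continuous fun x => fderiv ℝ v x (e i) := fun i =>
    cDv.clm_apply continuous_const
  have cdiU : ∀ i, Continuous fun x => fderiv ℝ U x (e i) := fun i =>
    cDU.clm_apply continuous_const
  have cddv : ∀ i, Continuous fun x => fderiv ℝ (fun y => fderiv ℝ v y (e i)) x (e i) := fun i =>
    ((((hv.fderiv_right (m := 1) (by norm_num)).clm_apply contDiff_const).continuous_fderiv
      (by norm_num)).clm_apply continuous_const)
  have cdiπ : ∀ i, Continuous fun x => fderiv ℝ π x (e i) := fun i => cDπ.clm_apply continuous_const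
  have cconv : Continuous (convect v v) := cDv.clm_apply cv
  -- pointwise norm facts
  have hM0 : 0 ≤ M := (norm_nonneg _).trans (hM 0)
  have hL0 : 0 ≤ L := (norm_nonneg _).trans (hL 0)
  have n_Δ : ∀ x, ‖(Δ v) x‖ ≤ ‖(3 : ℝ) • iteratedFDeriv ℝ 2 v x‖ := fun x => by
    rw [norm_smul, Real.norm_of_nonneg (by norm_num : (0 : ℝ) ≤ 3)]
    exact norm_laplacian_le_three_mul_norm_iteratedFDeriv_two hv x
  have n_gπ : ∀ x, ‖gradient π x‖ = ‖fderiv ℝ π x‖ := fun x => by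
    rw [gradient, LinearIsometryEquiv.norm_map]
  have hin : ∀ i (y : EuclideanSpace ℝ (Fin 3)), ‖⟪e i, y⟫‖ ≤ ‖y‖ := fun i y =>
    (norm_inner_le_norm (𝕜 := ℝ) (e i) y).trans (by rw [he1, one_mul])
  have n_conv : ∀ x, ‖convect v v x‖ ≤ ‖M * ‖fderiv ℝ v x‖‖ := fun x => by
    rw [Real.norm_of_nonneg (by positivity), convect, mul_comm]
    exact (fderiv ℝ v x).le_opNorm_of_le (hM x)
  -- the momentum equation solved for the pressure gradient
  have hgrad : ∀ x, gradient π x = ν • (Δ v) x - (W x + convect v v x) := fun x => by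
    rw [hmom x]; abel
  -- finite `L²` norms
  have l2Δ : ∫⁻ x, ‖(Δ v) x‖ₑ ^ 2 < ⊤ :=
    lintegral_enorm_sq_lt_top_of_norm_le n_Δ (lintegral_enorm_sq_const_smul_lt_top 3 l2D2v)
  have l2νΔ : ∫⁻ x, ‖ν • (Δ v) x‖ₑ ^ 2 < ⊤ := lintegral_enorm_sq_const_smul_lt_top ν l2Δ
  have l2conv : ∫⁻ x, ‖convect v v x‖ₑ ^ 2 < ⊤ := by
    have hb : ∫⁻ x, ‖M * ‖fderiv ℝ v x‖‖ₑ ^ 2 < ⊤ := by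
      have h := lintegral_enorm_sq_const_smul_lt_top M
        (lintegral_enorm_sq_lt_top_of_norm_le (fun x => by rw [norm_norm]) l2Dv :
          ∫⁻ x, ‖(‖fderiv ℝ v x‖)‖ₑ ^ 2 < ⊤)
      simpa only [smul_eq_mul] using h
    exact lintegral_enorm_sq_lt_top_of_norm_le n_conv hb
  have l2Wc : ∫⁻ x, ‖W x + convect v v x‖ₑ ^ 2 < ⊤ := by
    have hle : ∀ x, ‖W x + convect v v x‖ ≤ ‖W x‖ + ‖convect v v x‖ := fun x => norm_add_le _ _
    exact lintegral_enorm_sq_lt_top_of_norm_le_add hle hW.aestronglyMeasurable l2W l2conv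
  have l2gπ : ∫⁻ x, ‖gradient π x‖ₑ ^ 2 < ⊤ := by
    have hle : ∀ x, ‖gradient π x‖ ≤ ‖ν • (Δ v) x‖ + ‖W x + convect v v x‖ := fun x => by
      rw [hgrad x]; exact norm_sub_le _ _
    have hmeas : AEStronglyMeasurable (fun x => ν • (Δ v) x) volume :=
      (cΔ.const_smul ν).aestronglyMeasurable
    exact lintegral_enorm_sq_lt_top_of_norm_le_add hle hmeas l2νΔ l2Wc
  have l2Dπ : ∫⁻ x, ‖fderiv ℝ π x‖ₑ ^ 2 < ⊤ :=
    lintegral_enorm_sq_lt_top_of_norm_le (fun x => (n_gπ x).symm.le) l2gπ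
  have l2div : ∀ i, ∫⁻ x, ‖fderiv ℝ v x (e i)‖ₑ ^ 2 < ⊤ := fun i =>
    lintegral_enorm_sq_lt_top_of_norm_le (fun x => by
      simpa [he1] using (fderiv ℝ v x).le_opNorm (e i)) l2Dv
  have l2diU : ∀ i, ∫⁻ x, ‖fderiv ℝ U x (e i)‖ₑ ^ 2 < ⊤ := fun i =>
    lintegral_enorm_sq_lt_top_of_norm_le (fun x => by
      simpa [he1] using (fderiv ℝ U x).le_opNorm (e i)) l2DU
  have l2ddv : ∀ i, ∫⁻ x, ‖fderiv ℝ (fun y => fderiv ℝ v y (e i)) x (e i)‖ₑ ^ 2 < ⊤ := fun i =>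
    lintegral_enorm_sq_lt_top_of_norm_le (fun x => norm_fderiv_fderiv_apply_basisFun_le hv x i) l2D2v
  have l2diπ : ∀ i, ∫⁻ x, ‖fderiv ℝ π x (e i)‖ₑ ^ 2 < ⊤ := fun i =>
    lintegral_enorm_sq_lt_top_of_norm_le (fun x => by
      simpa [he1] using (fderiv ℝ π x).le_opNorm (e i)) l2Dπ
  -- integrability of the pairings with `U`
  have c3D2 : Continuous fun x => (3 : ℝ) • iteratedFDeriv ℝ 2 v x := cD2v.const_smul (3 : ℝ)
  have iUΔ : Integrable (fun x => ⟪U x, (Δ v) x⟫) volume :=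
    integrable_of_norm_le_mul_of_lintegral_sq (cU.inner cΔ).aestronglyMeasurable cU c3D2 l2U
      (lintegral_enorm_sq_const_smul_lt_top 3 l2D2v)
      fun x => (norm_inner_le_norm _ _).trans (mul_le_mul_of_nonneg_left (n_Δ x) (norm_nonneg _))
  have iUg : Integrable (fun x => ⟪U x, gradient π x⟫) volume :=
    integrable_of_norm_le_mul_of_lintegral_sq (cU.inner cgπ).aestronglyMeasurable cU cgπ l2U l2gπ
      fun x => norm_inner_le_norm _ _
  have iUc : Integrable (fun x => ⟪U x, convect v v x⟫) volume :=
    integrable_of_norm_le_mul_of_lintegral_sq (cU.inner cconv).aestronglyMeasurable cU cconv l2U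
      l2conv fun x => norm_inner_le_norm _ _
  have isqv : Integrable (fun x => ‖v x‖ ^ 2) volume := integrable_sq_norm_of_lintegral_lt_top cv l2v
  -- integrability of the Frobenius densities
  have ifrobv : Integrable (fun x => frobeniusNormSq (fderiv ℝ v x)) volume := by
    have hlt : ∫⁻ x, ENNReal.ofReal (frobeniusNormSq (fderiv ℝ v x)) < ⊤ :=
      calc ∫⁻ x, ENNReal.ofReal (frobeniusNormSq (fderiv ℝ v x))
          ≤ ∫⁻ x, 3 * ‖fderiv ℝ v x‖ₑ ^ 2 :=
            lintegral_mono fun x => ofReal_frobeniusNormSq_le_three_mul_enorm_sq _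
        _ = 3 * ∫⁻ x, ‖fderiv ℝ v x‖ₑ ^ 2 := lintegral_const_mul' _ _ (by norm_num)
        _ < ⊤ := ENNReal.mul_lt_top (by norm_num) l2Dv
    exact integrable_of_continuous_of_nonneg (continuous_frobeniusNormSq_fderiv hv (by simp))
      (fun x => frobeniusNormSq_nonneg _) hlt
  have ifrobU : Integrable (fun x => frobeniusNormSq (fderiv ℝ U x)) volume := by
    have hlt : ∫⁻ x, ENNReal.ofReal (frobeniusNormSq (fderiv ℝ U x)) < ⊤ :=
      calc ∫⁻ x, ENNReal.ofReal (frobeniusNormSq (fderiv ℝ U x))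
          ≤ ∫⁻ x, 3 * ‖fderiv ℝ U x‖ₑ ^ 2 :=
            lintegral_mono fun x => ofReal_frobeniusNormSq_le_three_mul_enorm_sq _
        _ = 3 * ∫⁻ x, ‖fderiv ℝ U x‖ₑ ^ 2 := lintegral_const_mul' _ _ (by norm_num)
        _ < ⊤ := ENNReal.mul_lt_top (by norm_num) l2DU
    exact integrable_of_continuous_of_nonneg (continuous_frobeniusNormSq_fderiv hU (by simp))
      (fun x => frobeniusNormSq_nonneg _) hlt
  -- (i) diffusion: `∫⟪U, Δv⟫ = −∫ Σ ⟪∂ᵢv, ∂ᵢU⟫`, `|Σ ⟪∂ᵢv, ∂ᵢU⟫| ≤ (η|Dv|² + η⁻¹|DU|²)/2`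
  have i1 : ∀ i, Integrable (fun x => ⟪fderiv ℝ (fun y => fderiv ℝ v y (e i)) x (e i), U x⟫)
      volume := fun i =>
    integrable_of_norm_le_mul_of_lintegral_sq ((cddv i).inner cU).aestronglyMeasurable (cddv i) cU
      (l2ddv i) l2U fun x => norm_inner_le_norm _ _
  have i2 : ∀ i, Integrable (fun x => ⟪fderiv ℝ v x (e i), fderiv ℝ U x (e i)⟫) volume := fun i =>
    integrable_of_norm_le_mul_of_lintegral_sq ((cdiv i).inner (cdiU i)).aestronglyMeasurable
      (cdiv i) (cdiU i) (l2div i) (l2diU i) fun x => norm_inner_le_norm _ _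
  have i3 : ∀ i, Integrable (fun x => ⟪fderiv ℝ v x (e i), U x⟫) volume := fun i =>
    integrable_of_norm_le_mul_of_lintegral_sq ((cdiv i).inner cU).aestronglyMeasurable (cdiv i) cU
      (l2div i) l2U fun x => norm_inner_le_norm _ _
  have hG := integral_sum_inner_fderiv_fderiv_eq_neg_integral_inner_laplacian hv hU i1 i2 i3
  have hisum : Integrable (fun x => ∑ i, ⟪fderiv ℝ v x (e i), fderiv ℝ U x (e i)⟫) volume :=
    integrable_finsetSum _ fun i _ => i2 i
  have hsum_pt : ∀ x, |∑ i, ⟪fderiv ℝ v x (e i), fderiv ℝ U x (e i)⟫| ≤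
      (η * frobeniusNormSq (fderiv ℝ v x) + η⁻¹ * frobeniusNormSq (fderiv ℝ U x)) / 2 := by
    intro x
    rw [frobeniusNormSq_eq_sum e (fderiv ℝ v x), frobeniusNormSq_eq_sum e (fderiv ℝ U x),
      Finset.mul_sum, Finset.mul_sum, ← Finset.sum_add_distrib, Finset.sum_div]
    refine (Finset.abs_sum_le_sum_abs _ _).trans (Finset.sum_le_sum fun i _ => ?_)
    have h1 : |⟪fderiv ℝ v x (e i), fderiv ℝ U x (e i)⟫| ≤
        ‖fderiv ℝ v x (e i)‖ * ‖fderiv ℝ U x (e i)‖ := abs_real_inner_le_norm _ _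
    exact h1.trans (mul_le_young hη)
  have hdiff : |∫ x, ⟪U x, (Δ v) x⟫| ≤
      (η * (∫ x, frobeniusNormSq (fderiv ℝ v x)) +
        η⁻¹ * ∫ x, frobeniusNormSq (fderiv ℝ U x)) / 2 := by
    have hcomm : ∫ x, ⟪U x, (Δ v) x⟫ = ∫ x, ⟪(Δ v) x, U x⟫ :=
      integral_congr_ae (Eventually.of_forall fun x => real_inner_comm _ _)
    have h1 : |∫ x, ⟪U x, (Δ v) x⟫| = |∫ x, ∑ i, ⟪fderiv ℝ v x (e i), fderiv ℝ U x (e i)⟫| := by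
      rw [hcomm, hG, abs_neg]
    rw [h1]
    refine (abs_integral_le_integral_abs).trans ?_
    have iR : Integrable (fun x => (η * frobeniusNormSq (fderiv ℝ v x) +
        η⁻¹ * frobeniusNormSq (fderiv ℝ U x)) / 2) volume :=
      ((ifrobv.const_mul η).add (ifrobU.const_mul η⁻¹)).div_const 2
    refine (integral_mono hisum.abs iR hsum_pt).trans (le_of_eq ?_)
    rw [integral_div, integral_add (ifrobv.const_mul η) (ifrobU.const_mul η⁻¹), integral_const_mul,
      integral_const_mul]
  -- (ii) pressure: `∫⟪U, ∇π⟫ = 0`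
  have hpress : ∫ x, ⟪U x, gradient π x⟫ = 0 := by
    have hswap : (fun x => ⟪U x, gradient π x⟫) = fun x => ⟪gradient π x, U x⟫ :=
      funext fun x => real_inner_comm _ _
    rw [hswap]
    refine integral_inner_gradient_eq_zero_of_isDivFree_R3 hπ hU hdivU (fun i => ?_) (fun i => ?_)
      (fun i => ?_)
    · refine integrable_of_norm_le_mul_of_lintegral_sq
        ((continuous_const.inner cU).mul (cdiπ i)).aestronglyMeasurable cU (cdiπ i) l2U (l2diπ i)
        fun x => ?_
      rw [norm_mul]
      exact mul_le_mul (hin i _) le_rfl (norm_nonneg _) (norm_nonneg _)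
    · refine integrable_of_norm_le_mul_of_lintegral_sq
        ((continuous_const.inner (cdiU i)).mul cπ).aestronglyMeasurable (cdiU i) cπ (l2diU i) l2π
        fun x => ?_
      rw [norm_mul]
      exact mul_le_mul (hin i _) le_rfl (norm_nonneg _) (norm_nonneg _)
    · refine integrable_of_norm_le_mul_of_lintegral_sq
        ((continuous_const.inner cU).mul cπ).aestronglyMeasurable cU cπ l2U l2π fun x => ?_
      rw [norm_mul]
      exact mul_le_mul (hin i _) le_rfl (norm_nonneg _) (norm_nonneg _)
  -- (iii) transport: `|⟪U, (v·∇)v⟫| ≤ L‖Dv‖‖v‖ ≤ (η|Dv|²_F + η⁻¹L²‖v‖²)/2`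
  have htrans_pt : ∀ x, |⟪U x, convect v v x⟫| ≤
      (η * frobeniusNormSq (fderiv ℝ v x) + η⁻¹ * (L ^ 2 * ‖v x‖ ^ 2)) / 2 := by
    intro x
    have h1 : |⟪U x, convect v v x⟫| ≤ ‖fderiv ℝ v x‖ * (L * ‖v x‖) := by
      calc |⟪U x, convect v v x⟫| ≤ ‖U x‖ * ‖convect v v x‖ := abs_real_inner_le_norm _ _
        _ ≤ L * (‖fderiv ℝ v x‖ * ‖v x‖) :=
            mul_le_mul (hL x) ((fderiv ℝ v x).le_opNorm (v x)) (norm_nonneg _) hL0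
        _ = ‖fderiv ℝ v x‖ * (L * ‖v x‖) := by ring
    have h2 := mul_le_young (a := ‖fderiv ℝ v x‖) (b := L * ‖v x‖) hη
    have h3 : η * ‖fderiv ℝ v x‖ ^ 2 ≤ η * frobeniusNormSq (fderiv ℝ v x) :=
      mul_le_mul_of_nonneg_left (sq_opNorm_le_frobeniusNormSq _) hη.le
    have h4 : (L * ‖v x‖) ^ 2 = L ^ 2 * ‖v x‖ ^ 2 := by ring
    rw [h4] at h2
    have hηi : 0 ≤ η⁻¹ := inv_nonneg.2 hη.le
    linarith
  have htrans : |∫ x, ⟪U x, convect v v x⟫| ≤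
      (η * (∫ x, frobeniusNormSq (fderiv ℝ v x)) + η⁻¹ * (L ^ 2 * ∫ x, ‖v x‖ ^ 2)) / 2 := by
    refine (abs_integral_le_integral_abs).trans ?_
    have iR : Integrable (fun x => (η * frobeniusNormSq (fderiv ℝ v x) +
        η⁻¹ * (L ^ 2 * ‖v x‖ ^ 2)) / 2) volume :=
      ((ifrobv.const_mul η).add ((isqv.const_mul (L ^ 2)).const_mul η⁻¹)).div_const 2
    refine (integral_mono iUc.abs iR htrans_pt).trans (le_of_eq ?_)
    rw [integral_div, integral_add (ifrobv.const_mul η) ((isqv.const_mul (L ^ 2)).const_mul η⁻¹),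
      integral_const_mul, integral_const_mul, integral_const_mul]
  -- assemble: `⟪U, W⟫ = ν⟪U, Δv⟫ - ⟪U, ∇π⟫ - ⟪U, (v·∇)v⟫`
  have hW_eq : ∀ x, W x = ν • (Δ v) x - gradient π x - convect v v x := fun x => by
    rw [← hmom x]; abel
  have hsplit : ∫ x, ⟪U x, W x⟫ =
      ν * (∫ x, ⟪U x, (Δ v) x⟫) - (∫ x, ⟪U x, gradient π x⟫) - ∫ x, ⟪U x, convect v v x⟫ := by
    have e1 : (fun x => ⟪U x, W x⟫) =
        fun x => (ν * ⟪U x, (Δ v) x⟫ - ⟪U x, gradient π x⟫) - ⟪U x, convect v v x⟫ := by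
      funext x
      rw [hW_eq x, inner_sub_right, inner_sub_right, real_inner_smul_right]
    have i12 : Integrable (fun x => ν * ⟪U x, (Δ v) x⟫ - ⟪U x, gradient π x⟫) volume :=
      (iUΔ.const_mul ν).sub iUg
    rw [e1, integral_sub i12 iUc, integral_sub (iUΔ.const_mul ν) iUg, integral_const_mul]
  rw [hsplit, hpress, sub_zero]
  have hA := mul_le_mul_of_nonneg_left hdiff hν
  have hfin : |ν * (∫ x, ⟪U x, (Δ v) x⟫) - ∫ x, ⟪U x, convect v v x⟫| ≤
      ν * |∫ x, ⟪U x, (Δ v) x⟫| + |∫ x, ⟪U x, convect v v x⟫| := by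
    refine (abs_sub _ _).trans ?_
    rw [abs_mul, abs_of_nonneg hν]
  refine hfin.trans ?_
  have e2 : (ν + 1) / 2 * η * (∫ x, frobeniusNormSq (fderiv ℝ v x)) +
      (ν * (∫ x, frobeniusNormSq (fderiv ℝ U x)) + L ^ 2 * ∫ x, ‖v x‖ ^ 2) / (2 * η) =
      ν * ((η * (∫ x, frobeniusNormSq (fderiv ℝ v x)) +
        η⁻¹ * ∫ x, frobeniusNormSq (fderiv ℝ U x)) / 2) +
      (η * (∫ x, frobeniusNormSq (fderiv ℝ v x)) + η⁻¹ * (L ^ 2 * ∫ x, ‖v x‖ ^ 2)) / 2 := by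
    field_simp
    ring
  rw [e2]
  exact add_le_add hA htrans

/-- **The pairing estimate at an interior time of a closed slab, in Tao's class.** For `ν > 0`,
`S > 0`, an unforced classical solution `(u, p)` on `[0, S] × ℝ³` with all spatial `L²`-Sobolev norms
of `u` bounded on `[0, S]` (`HasBoundedSobolevNormsOn`) and `∫‖u(t)‖² ≤ I₀` on `[0,S]`, an interior
time `τ ∈ (0, S)`, and a frozen `C¹` divergence-free field `U` with `‖U‖ ≤ L`, `U, DU ∈ L²`: for every
`η > 0`, `|∫⟪U, ∂ₜu(τ)⟫| ≤ ((ν+1)/2) η ∫|Du(τ)|²_F + (ν∫|DU|²_F + L² I₀)/(2η)`. The hypotheses of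
`pairing_timeDeriv_abs_le` are supplied by the class exactly as in `EdgeLaw.slice_le_of_classical`
(`∂ₜu(τ) ∈ L²`: `exists_lintegral_enorm_timeDerivWithin_sq_le`; normalised pressure at interior
times: `pressure_sub_pressurePotential_eq`, `integral_normalisedPressure_sq_le_of_bound`). [folklore] -/
theorem pairing_timeDeriv_abs_le_of_classical {ν S : ℝ} (hν : 0 < ν) (hS : 0 < S)
    {u : ℝ → EuclideanSpace ℝ (Fin 3) → EuclideanSpace ℝ (Fin 3)} {p : ℝ → EuclideanSpace ℝ (Fin 3) → ℝ}
    (hsol : IsClassicalNSSolutionOn (Icc 0 S) ν 0 u p) (hB : HasBoundedSobolevNormsOn (Icc 0 S) u)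
    {I₀ : ℝ} (hI₀le : ∀ t ∈ Icc 0 S, ∫ x, ‖u t x‖ ^ 2 ≤ I₀)
    {τ : ℝ} (hτ : τ ∈ Ioo 0 S) {U : EuclideanSpace ℝ (Fin 3) → EuclideanSpace ℝ (Fin 3)}
    (hU : ContDiff ℝ 1 U) (hdivU : VectorCalculus.IsDivFree U) {L : ℝ} (hL : ∀ x, ‖U x‖ ≤ L)
    (l2U : ∫⁻ x, ‖U x‖ₑ ^ 2 < ⊤) (l2DU : ∫⁻ x, ‖fderiv ℝ U x‖ₑ ^ 2 < ⊤) {η : ℝ} (hη : 0 < η) :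
    |∫ x, ⟪U x, timeDerivWithin (Icc 0 S) u τ x⟫| ≤
      (ν + 1) / 2 * η * (∫ x, frobeniusNormSq (fderiv ℝ (u τ) x)) +
        (ν * (∫ x, frobeniusNormSq (fderiv ℝ U x)) + L ^ 2 * I₀) / (2 * η) := by
  have hτ' : τ ∈ Icc 0 S := Ioo_subset_Icc_self hτ
  have hu : ∀ t ∈ Icc 0 S, ContDiff ℝ ∞ (u t) := fun t ht => hsol.contDiff_velocity ht
  -- class data: energy and a uniform bound
  obtain ⟨⟨I₁, hI₁⟩, -⟩ := levelSq_bounds_of_hasBoundedSobolevNormsOn hu hB 0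
  obtain ⟨B₀, -, hB₀⟩ := exists_forall_norm_iteratedFDeriv_le_bkmClass hu hB 0
  have huB : ∀ t ∈ Icc 0 S, ∀ x, ‖u t x‖ ≤ B₀ := fun t ht x => by
    have := hB₀ t ht x; rwa [norm_iteratedFDeriv_zero] at this
  have hE_int : ∀ t ∈ Icc 0 S, Integrable fun x => ‖u t x‖ ^ 2 := fun t ht =>
    (hI₁ t ht).1.congr (Eventually.of_forall fun x => levelSq_zero_eq_norm_sq (u t) x)
  have hE_le : ∀ t ∈ Icc 0 S, ∫ x, ‖u t x‖ ^ 2 ≤ I₁ := fun t ht => by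
    rw [← integral_congr_ae (Eventually.of_forall fun x => levelSq_zero_eq_norm_sq (u t) x)]
    exact (hI₁ t ht).2
  have hI₁0 : 0 ≤ I₁ := (integral_nonneg fun x => sq_nonneg _).trans (hE_le τ hτ')
  -- the pressure at the interior time `τ` is the normalised one up to a constant
  obtain ⟨c₀, hc₀⟩ : ∃ c₀ : ℝ, c₀ = p τ 0 - pressurePotential (u τ) 0 := ⟨_, rfl⟩
  have hQ : ∀ x, p τ x = normalisedPressure (u τ) x + c₀ := by
    intro x
    have h1 := pressure_sub_pressurePotential_eq hν.le hsol hI₁0 hE_int hE_le hτ x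
    rw [normalisedPressure_eq_pressurePotential ((hu τ hτ').of_le (by norm_cast)) (hE_int τ hτ') x,
      hc₀]
    linarith
  obtain ⟨hQ2, -⟩ := integral_normalisedPressure_sq_le_of_bound (hu τ hτ') (hE_int τ hτ')
    (hE_le τ hτ') (huB τ hτ')
  obtain ⟨π, hπdef⟩ : ∃ π : EuclideanSpace ℝ (Fin 3) → ℝ, π = fun x => p τ x - c₀ := ⟨_, rfl⟩
  have hπQ : ∀ x, π x = normalisedPressure (u τ) x := fun x => by rw [hπdef]; simp only [hQ x]; ring
  have hπ : ContDiff ℝ 1 π := by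
    rw [hπdef]; exact ((hsol.contDiff_pressure hτ').sub contDiff_const).of_le (by norm_cast)
  have hgradπ : ∀ x, gradient π x = gradient (p τ) x := fun x => by
    rw [hπdef, gradient, gradient, fderiv_sub_const]
  have l2π : ∫⁻ x, ‖π x‖ₑ ^ 2 < ⊤ := by
    have h1 : ∀ x, ‖π x‖ₑ ^ 2 = ‖normalisedPressure (u τ) x ^ 2‖ₑ := fun x => by
      rw [hπQ x, enorm_pow]
    simp_rw [h1]
    exact hQ2.2
  -- the momentum equation at `τ` (no force), with the shifted pressure
  have hmom : ∀ x, timeDerivWithin (Icc 0 S) u τ x + convect (u τ) (u τ) x =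
      ν • (Δ (u τ)) x - gradient π x := fun x => by
    rw [hgradπ x]; simpa using hsol.momentum τ hτ' x
  -- `∂ₜu(τ)` is continuous and in `L²`
  have hW : Continuous (timeDerivWithin (Icc 0 S) u τ) :=
    ((hsol.smooth_velocity.timeDerivWithin (uniqueDiffOn_Icc hS)).contDiff_slice hτ').continuous
  obtain ⟨Λ, hΛtop, hΛ⟩ := hsol.exists_lintegral_enorm_timeDerivWithin_sq_le hν.le hS hB
  have l2W : ∫⁻ x, ‖timeDerivWithin (Icc 0 S) u τ x‖ₑ ^ 2 < ⊤ :=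
    (hΛ τ hτ').trans_lt hΛtop.lt_top
  -- Sobolev norms of the slice `u(τ)`
  obtain ⟨C₀, hC₀⟩ := hB 0
  obtain ⟨C₁, hC₁⟩ := hB 1
  obtain ⟨C₂, hC₂⟩ := hB 2
  have l2v : ∫⁻ x, ‖u τ x‖ₑ ^ 2 < ⊤ := by
    refine lt_of_le_of_lt (le_of_eq (lintegral_congr fun x => ?_))
      ((hC₀ τ hτ').trans_lt ENNReal.coe_lt_top)
    rw [← ofReal_norm, ← ofReal_norm, norm_iteratedFDeriv_zero]
  have l2Dv : ∫⁻ x, ‖fderiv ℝ (u τ) x‖ₑ ^ 2 < ⊤ :=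
    lintegral_enorm_sq_lt_top_of_norm_le (fun x => by
      rw [← norm_iteratedFDeriv_fderiv, norm_iteratedFDeriv_zero])
      ((hC₁ τ hτ').trans_lt ENNReal.coe_lt_top)
  have l2D2v : ∫⁻ x, ‖iteratedFDeriv ℝ 2 (u τ) x‖ₑ ^ 2 < ⊤ :=
    (hC₂ τ hτ').trans_lt ENNReal.coe_lt_top
  have h := pairing_timeDeriv_abs_le hν.le ((hu τ hτ').of_le (by norm_cast)) hU hW hπ hmom hdivU
    (huB τ hτ') hL l2v l2Dv l2D2v l2U l2DU l2W l2π hη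
  -- replace `∫‖u τ‖²` by `I₀`
  have hL2 : 0 ≤ L ^ 2 := sq_nonneg _
  have hmono : (ν * (∫ x, frobeniusNormSq (fderiv ℝ U x)) + L ^ 2 * ∫ x, ‖u τ x‖ ^ 2) / (2 * η) ≤
      (ν * (∫ x, frobeniusNormSq (fderiv ℝ U x)) + L ^ 2 * I₀) / (2 * η) := by
    refine div_le_div_of_nonneg_right ?_ (by positivity)
    exact add_le_add le_rfl (mul_le_mul_of_nonneg_left (hI₀le τ hτ') hL2)
  exact h.trans (add_le_add le_rfl hmono)

end NoTerminalJolt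

end Summit.NavierStokesRegularity.NavierStokesRegularity.Theorems

end
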